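import Summits.QuantumFields.YangMills.Theorems.AllWindowsColdBoxBoxHighLineGaussAvgTransfer
import Summits.QuantumFields.YangMills.Theorems.AllWindowsColdBoxBoxHighLineWickTwoPairsSides
import Summits.QuantumFields.YangMills.Theorems.AllWindowsColdBoxBoxHighLineTripleBond
import Summits.QuantumFields.YangMills.Theorems.AllWindowsColdBoxBoxHighLineQuadFormSplit

/-!
# `ConnectedFourPoint`, cubic pair — preliminaries: the curvature leg as four coordinate legs, and the summed per-monomial connected bound

LEAD seat `ym-line-sfw-p2` (g78), cell ym-idea-1; U5 prep, helper-grade (`U5-BLOCKERS.md` §2 lift L3).  Tools for the per-pair estimate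
✓`…ConnectedFourPointPair` (next file):

* `linCurv_plaq12At_eq_sum`, `curvForm_eq_sum_single` — by ✓7e `quadFormSplit`, the linearised curvature `ℓ^c_{plaq12At z}` (and its flat linear form)
  is the signed sum of at most four coordinate legs `a_e^c` over the free edges `e` of the plaquette (✓`freeVec_apply_eq_sum`);
* `abs_sum_ite_edge_le`, `abs_curvForm_propagator_le` — hence every propagator of the curvature leg is at most `4×` a per-edge bound;
* `abs_sum_connected_twoVertex_le` — the `(k,k')`-sum of ✓`WickTwoPairs.abs_connected_wick22_twoVertex_le` over two vertices written as finite sums of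
  three-leg monomials (`Σ|c_k| ≤ S`, `Σ|c'_{k'}| ≤ S'`): `≤ S·S'·(864·m·M²·(αxβy+αyβx) + 324·M·(αxβy+αyβx)²)`.

Tree only + Mathlib; no definitions; standard axioms.  HONEST LABEL: bookkeeping for the RECORDED lift L3 of the NEXT rung U5 (⟨stmt-QuantumFields-24336⟩, UNSTAFFED);
⟨24004⟩ ⟨24336⟩ and this seat's crux ⟨stmt-QuantumFields-22884⟩ remain OPEN; route AllWindowsColdBox is DRAFT; no crux, rung or summit is proved; **the
Yang–Mills mass gap is NOT proved by this file; no summit is proved by a line.**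
-/

set_option autoImplicit false

noncomputable section

open MeasureTheory ProbabilityTheory Matrix Finset
open scoped Kronecker
open Literature.Probability.LatticeModels (Site)
open Literature.MathematicalPhysics.QuantumLattice (ZdPlaquette plaquettesTouching)
open Summit.QuantumFields.YangMills.Theorems.WeakCouplingRates (plaq12At)

namespace Summit.QuantumFields.YangMills.Theorems.AllWindowsColdBoxBoxHighLine

namespace EdgeChartGaussian

open LaplaceSandwich (flatten flatten_apply flatten_symm_apply)
open GaussianChartWick WickTwoPairs
open Literature.Probability.Distributions.GaussianWick

/-- ★ The linearised curvature of `plaq12At x₀` as a SIGNED SUM OF AT MOST FOUR COORDINATE LEGS: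
`ℓ^c(a) = Σ_e[e = e₀]a_e^c + Σ_e[e = e₁]a_e^c − Σ_e[e = e₂]a_e^c − Σ_e[e = e₃]a_e^c`, `e_i = plaqEdge x₀ 1 2 i` (✓7e `quadFormSplit` + ✓`freeVec_apply_eq_sum`). -/
theorem linCurv_plaq12At_eq_sum (H : ℕ) (hH : 1 ≤ H) (x₀ : Site 4) (a : LandauFree H → E3) (c : Fin 3) :
    linCurv H (plaq12At x₀) a c =
      (∑ e : LandauFree H, if (e.1.1 : Literature.MathematicalPhysics.QuantumLattice.ZdEdge 4) = plaqEdge x₀ 1 2 0 then a e c else 0)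
      + (∑ e : LandauFree H, if (e.1.1 : Literature.MathematicalPhysics.QuantumLattice.ZdEdge 4) = plaqEdge x₀ 1 2 1 then a e c else 0)
      - (∑ e : LandauFree H, if (e.1.1 : Literature.MathematicalPhysics.QuantumLattice.ZdEdge 4) = plaqEdge x₀ 1 2 2 then a e c else 0)
      - (∑ e : LandauFree H, if (e.1.1 : Literature.MathematicalPhysics.QuantumLattice.ZdEdge 4) = plaqEdge x₀ 1 2 3 then a e c else 0) := by
  classical
  have h := (quadFormSplit H hH a).2 x₀ 1 2 c (by decide)
  rw [show plaq12At x₀ = (x₀, 1, 2) from rfl, h, plaqLin]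
  simp only [PiLp.add_apply, PiLp.sub_apply, plaqVar, freeVec_apply_eq_sum]

/-- At most one free edge sits on a given lattice edge: a sum of `[e = ed]·g e` is bounded by any uniform bound `b ≥ 0` of `|g|` on that fibre. -/
theorem abs_sum_ite_edge_le {H : ℕ} (ed : Literature.MathematicalPhysics.QuantumLattice.ZdEdge 4) (g : LandauFree H → ℝ) {b : ℝ} (hb : 0 ≤ b)
    (hg : ∀ e : LandauFree H, (e.1.1 : Literature.MathematicalPhysics.QuantumLattice.ZdEdge 4) = ed → |g e| ≤ b) :
    |∑ e : LandauFree H, if (e.1.1 : Literature.MathematicalPhysics.QuantumLattice.ZdEdge 4) = ed then g e else 0| ≤ b := by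
  classical
  rw [← Finset.sum_filter]
  have hcard : (Finset.univ.filter fun e : LandauFree H =>
      (e.1.1 : Literature.MathematicalPhysics.QuantumLattice.ZdEdge 4) = ed).card ≤ 1 := by
    refine Finset.card_le_one.2 fun e he e' he' => ?_
    rw [Finset.mem_filter] at he he'
    exact landauFree_ext (he.2.trans he'.2.symm)
  refine (Finset.abs_sum_le_sum_abs _ _).trans ?_
  calc ∑ e ∈ Finset.univ.filter (fun e : LandauFree H => (e.1.1 : Literature.MathematicalPhysics.QuantumLattice.ZdEdge 4) = ed), |g e|
      ≤ ∑ _e ∈ Finset.univ.filter (fun e : LandauFree H => (e.1.1 : Literature.MathematicalPhysics.QuantumLattice.ZdEdge 4) = ed), b :=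
        Finset.sum_le_sum fun e he => hg e (Finset.mem_filter.1 he).2
    _ ≤ b := by
        rw [Finset.sum_const, nsmul_eq_mul]
        calc ((Finset.univ.filter fun e : LandauFree H => (e.1.1 : Literature.MathematicalPhysics.QuantumLattice.ZdEdge 4) = ed).card : ℝ) * b
            ≤ 1 * b := mul_le_mul_of_nonneg_right (by exact_mod_cast hcard) hb
          _ = b := one_mul b

/-- ★ The flat linear form of `ℓ^c_{plaq12At z}` IS the signed sum of (at most four) coordinate forms `e_{(e,c)}` over the free edges of the plaquette. -/
theorem curvForm_eq_sum_single (H : ℕ) (hH : 1 ≤ H) (z : Site 4) (c : Fin 3) :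
    (fun q : LandauFree H × Fin 3 => if q.2 = c then landauCoeff H (plaq12At z) q.1 else 0) =
      (∑ e : LandauFree H, if (e.1.1 : Literature.MathematicalPhysics.QuantumLattice.ZdEdge 4) = plaqEdge z 1 2 0 then Pi.single (e, c) (1 : ℝ) else 0)
      + (∑ e : LandauFree H, if (e.1.1 : Literature.MathematicalPhysics.QuantumLattice.ZdEdge 4) = plaqEdge z 1 2 1 then Pi.single (e, c) (1 : ℝ) else 0)
      - (∑ e : LandauFree H, if (e.1.1 : Literature.MathematicalPhysics.QuantumLattice.ZdEdge 4) = plaqEdge z 1 2 2 then Pi.single (e, c) (1 : ℝ) else 0)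
      - (∑ e : LandauFree H, if (e.1.1 : Literature.MathematicalPhysics.QuantumLattice.ZdEdge 4) = plaqEdge z 1 2 3 then Pi.single (e, c) (1 : ℝ) else 0) := by
  classical
  funext q
  have h := linCurv_plaq12At_eq_sum H hH z ((flatten (LandauFree H)).symm (Pi.single q 1)) c
  rw [linCurv_eq_dotProduct_flatten, MeasurableEquiv.apply_symm_apply, dotProduct_comm, single_one_dotProduct] at h
  simp only [flatten_symm_apply] at h
  rw [h]
  have happ : ∀ i : Fin 4, (∑ e : LandauFree H, if (e.1.1 : Literature.MathematicalPhysics.QuantumLattice.ZdEdge 4) = plaqEdge z 1 2 i then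
      (Pi.single (e, c) (1 : ℝ) : LandauFree H × Fin 3 → ℝ) else 0) q =
      ∑ e : LandauFree H, if (e.1.1 : Literature.MathematicalPhysics.QuantumLattice.ZdEdge 4) = plaqEdge z 1 2 i then
        (Pi.single q (1 : ℝ) : LandauFree H × Fin 3 → ℝ) (e, c) else 0 := by
    intro i
    rw [Finset.sum_apply]
    refine Finset.sum_congr rfl fun e _ => ?_
    split_ifs
    · simp only [Pi.single_apply, @eq_comm _ q]
    · rfl
  simp only [Pi.add_apply, Pi.sub_apply, happ]

/-- ★ **The curvature form contracts like at most four coordinate legs**: if every free edge `e` on the plaquette obeys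
`|(2β)⁻¹·e_{(e,c)}⬝P⁻¹t'| ≤ b` (`b ≥ 0`), then `|(2β)⁻¹·ℓ̂^c_z ⬝ P⁻¹ t'| ≤ 4b` (`P = hodgeQ H ⊗ 1₃`). -/
theorem abs_curvForm_propagator_le (H : ℕ) (hH : 1 ≤ H) (β : ℝ) (z : Site 4) (c : Fin 3) (t' : LandauFree H × Fin 3 → ℝ) {b : ℝ} (hb : 0 ≤ b)
    (hfib : ∀ (i : Fin 4) (e : LandauFree H), (e.1.1 : Literature.MathematicalPhysics.QuantumLattice.ZdEdge 4) = plaqEdge z 1 2 i →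
      |(2 * β)⁻¹ * (Pi.single (e, c) (1 : ℝ) ⬝ᵥ ((hodgeQ H ⊗ₖ (1 : Matrix (Fin 3) (Fin 3) ℝ))⁻¹ *ᵥ t'))| ≤ b) :
    |(2 * β)⁻¹ * ((fun q : LandauFree H × Fin 3 => if q.2 = c then landauCoeff H (plaq12At z) q.1 else 0) ⬝ᵥ
        ((hodgeQ H ⊗ₖ (1 : Matrix (Fin 3) (Fin 3) ℝ))⁻¹ *ᵥ t'))| ≤ 4 * b := by
  classical
  set v := (hodgeQ H ⊗ₖ (1 : Matrix (Fin 3) (Fin 3) ℝ))⁻¹ *ᵥ t' with hv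
  have hS : ∀ i : Fin 4, (2 * β)⁻¹ * ((∑ e : LandauFree H, if (e.1.1 : Literature.MathematicalPhysics.QuantumLattice.ZdEdge 4) = plaqEdge z 1 2 i then
      Pi.single (e, c) (1 : ℝ) else 0) ⬝ᵥ v) =
      ∑ e : LandauFree H, if (e.1.1 : Literature.MathematicalPhysics.QuantumLattice.ZdEdge 4) = plaqEdge z 1 2 i then
        (2 * β)⁻¹ * (Pi.single (e, c) (1 : ℝ) ⬝ᵥ v) else 0 := by
    intro i
    rw [sum_dotProduct, Finset.mul_sum]
    refine Finset.sum_congr rfl fun e _ => ?_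
    split_ifs
    · rfl
    · rw [zero_dotProduct, mul_zero]
  have hI : ∀ i : Fin 4, |∑ e : LandauFree H, if (e.1.1 : Literature.MathematicalPhysics.QuantumLattice.ZdEdge 4) = plaqEdge z 1 2 i then
      (2 * β)⁻¹ * (Pi.single (e, c) (1 : ℝ) ⬝ᵥ v) else 0| ≤ b := fun i => abs_sum_ite_edge_le _ _ hb fun e he => hfib i e he
  rw [curvForm_eq_sum_single H hH z c, sub_dotProduct, sub_dotProduct, add_dotProduct, mul_sub, mul_sub, mul_add, hS, hS, hS, hS]
  have h0' := hI 0; have h1' := hI 1; have h2' := hI 2; have h3' := hI 3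
  have key : ∀ I0 I1 I2 I3 : ℝ, |I0| ≤ b → |I1| ≤ b → |I2| ≤ b → |I3| ≤ b → |I0 + I1 - I2 - I3| ≤ 4 * b := by
    intro I0 I1 I2 I3 h0' h1' h2' h3'
    have := abs_sub (I0 + I1 - I2) I3; have := abs_sub (I0 + I1) I2; have := abs_add_le I0 I1; linarith
  exact key _ _ _ _ h0' h1' h2' h3'

/-- ★ **SUMMING THE PER-MONOMIAL CONNECTED BOUND** (process level): two Wick squares `:X_a²:`, `:X_b²:` against the product of two vertices given
as finite sums `Σ_k c_k ∏_{s<3} X_{legA k s}`, `Σ_{k'} c'_{k'} ∏ X_{legB k' s}` whose nonzero monomials have uncorrelated legs inside, cross-correlation `≤ M`,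
and pair–vertex correlations `≤ αx, αy, βx, βy`, `|E X_aX_b| ≤ m`: the `(k,k')`-sum of the connected parts is at most
`(Σ|c|)(Σ|c'|)·(864·m·M²·(αxβy + αyβx) + 324·M·(αxβy + αyβx)²)` (✓`abs_connected_wick22_twoVertex_le` term by term). -/
theorem abs_sum_connected_twoVertex_le {T Ω : Type*} [MeasurableSpace Ω] {P : Measure Ω} {X : T → Ω → ℝ}
    (hX : IsGaussianProcess X P) (h0 : ∀ t, ∫ ω, X t ω ∂P = 0)
    {KA KB : Type*} [Fintype KA] [Fintype KB] (cA : KA → ℝ) (cB : KB → ℝ) (legA : KA → Fin 3 → T) (legB : KB → Fin 3 → T)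
    (a b : T) {SA SB M m αx αy βx βy : ℝ} (hM : 0 ≤ M) (hm : 0 ≤ m) (hαx : 0 ≤ αx) (hαy : 0 ≤ αy) (hβx : 0 ≤ βx) (hβy : 0 ≤ βy)
    (hsumA : ∑ k, |cA k| ≤ SA) (hsumB : ∑ k, |cB k| ≤ SB)
    (hu : ∀ k, cA k ≠ 0 → ∀ s s', s ≠ s' → ∫ ω, X (legA k s) ω * X (legA k s') ω ∂P = 0)
    (hw : ∀ k, cB k ≠ 0 → ∀ s s', s ≠ s' → ∫ ω, X (legB k s) ω * X (legB k s') ω ∂P = 0)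
    (hcross : ∀ k k', cA k ≠ 0 → cB k' ≠ 0 → ∀ s s', |∫ ω, X (legA k s) ω * X (legB k' s') ω ∂P| ≤ M)
    (hab : |∫ ω, X a ω * X b ω ∂P| ≤ m)
    (hax : ∀ k, cA k ≠ 0 → ∀ s, |∫ ω, X a ω * X (legA k s) ω ∂P| ≤ αx)
    (hay : ∀ k', cB k' ≠ 0 → ∀ s, |∫ ω, X a ω * X (legB k' s) ω ∂P| ≤ αy)
    (hbx : ∀ k, cA k ≠ 0 → ∀ s, |∫ ω, X b ω * X (legA k s) ω ∂P| ≤ βx)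
    (hby : ∀ k', cB k' ≠ 0 → ∀ s, |∫ ω, X b ω * X (legB k' s) ω ∂P| ≤ βy) :
    |∑ k, ∑ k', cA k * cB k' *
        (∫ ω, (X a ω * X a ω - ∫ ω', X a ω' * X a ω' ∂P) * (X b ω * X b ω - ∫ ω', X b ω' * X b ω' ∂P) *
              ∏ j : Fin 3 ⊕ Fin 3, X (Sum.elim (legA k) (legB k') j) ω ∂P
          - (∫ ω, (X a ω * X a ω - ∫ ω', X a ω' * X a ω' ∂P) * (X b ω * X b ω - ∫ ω', X b ω' * X b ω' ∂P) ∂P) *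
              ∫ ω, ∏ j : Fin 3 ⊕ Fin 3, X (Sum.elim (legA k) (legB k') j) ω ∂P)| ≤
      SA * SB * (864 * m * M ^ 2 * (αx * βy + αy * βx) + 324 * M * (αx * βy + αy * βx) ^ 2) := by
  set Bnd := 864 * m * M ^ 2 * (αx * βy + αy * βx) + 324 * M * (αx * βy + αy * βx) ^ 2 with hBnd
  have hBnd0 : 0 ≤ Bnd := by positivity
  have hSA : 0 ≤ SA := (Finset.sum_nonneg fun _ _ => abs_nonneg _).trans hsumA
  have hterm : ∀ k k', |cA k * cB k' *
        (∫ ω, (X a ω * X a ω - ∫ ω', X a ω' * X a ω' ∂P) * (X b ω * X b ω - ∫ ω', X b ω' * X b ω' ∂P) *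
              ∏ j : Fin 3 ⊕ Fin 3, X (Sum.elim (legA k) (legB k') j) ω ∂P
          - (∫ ω, (X a ω * X a ω - ∫ ω', X a ω' * X a ω' ∂P) * (X b ω * X b ω - ∫ ω', X b ω' * X b ω' ∂P) ∂P) *
              ∫ ω, ∏ j : Fin 3 ⊕ Fin 3, X (Sum.elim (legA k) (legB k') j) ω ∂P)| ≤ |cA k| * |cB k'| * Bnd := by
    intro k k'
    rw [abs_mul, abs_mul]
    by_cases hk : cA k = 0
    · rw [hk, abs_zero, zero_mul, zero_mul, zero_mul]
    by_cases hk' : cB k' = 0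
    · rw [hk', abs_zero, mul_zero, zero_mul, zero_mul]
    refine mul_le_mul_of_nonneg_left ?_ (mul_nonneg (abs_nonneg _) (abs_nonneg _))
    exact abs_connected_wick22_twoVertex_le hX h0 (legA k) (legB k') a b hM (hu k hk) (hw k' hk') (hcross k k' hk hk') hab
      (hax k hk) (hay k' hk') (hbx k hk) (hby k' hk')
  calc _ ≤ ∑ k, ∑ k', |cA k| * |cB k'| * Bnd := by
        refine (Finset.abs_sum_le_sum_abs _ _).trans (Finset.sum_le_sum fun k _ => ?_)
        exact (Finset.abs_sum_le_sum_abs _ _).trans (Finset.sum_le_sum fun k' _ => hterm k k')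
    _ = (∑ k, |cA k|) * (∑ k', |cB k'|) * Bnd := by
        rw [Finset.sum_mul_sum, Finset.sum_mul]
        refine Finset.sum_congr rfl fun k _ => ?_
        rw [Finset.sum_mul]
    _ ≤ SA * SB * Bnd := by
        refine mul_le_mul_of_nonneg_right ?_ hBnd0
        exact mul_le_mul hsumA hsumB (Finset.sum_nonneg fun _ _ => abs_nonneg _) hSA

end EdgeChartGaussian

end Summit.QuantumFields.YangMills.Theorems.AllWindowsColdBoxBoxHighLine

end
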